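import Mathlib
import Summits.ValiantsHypothesis.ValiantsHypothesis.Theorems.FifoMatchingNNDivisionHardThickMeasureSupport
import Summits.ValiantsHypothesis.ValiantsHypothesis.Theorems.FifoMatchingNNDivisionHardPadWordLongArcs
import Summits.ValiantsHypothesis.ValiantsHypothesis.Theorems.FifoMatchingNNMonotoneExpBound
import HarnessLib

/-!
# Route FifoMatching — crux `NNDivisionHard` (stmt-ValiantsHypothesis-21181): the LONG-ARC thick-queue engine

The thick-queue engine of record (`SpreadLaw.exp_lower_bound_of_spreadLaw`: any cost `F : ℕ → ℕ` obeying the spread law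
`1 ≤ 4 F(n) (n+1)² β` for EVERY spread probability weighting is `≥ 2^{n^{1/6}}` eventually) is sharpened to the support of
the measure actually used: by `ThickMeasureSupport.exists_thick_measure_supported` + `PadWordLongArcs.cast_fifo_padWord_arcs_long`
the thick-queue measure lives on matchings ALL OF WHOSE ARCS HAVE LENGTH `≥ ℓ₀ = L − m + 1 = 8u⁴ + 2u³ + 1`, and at the
parameters of `NNMonotoneExpBound` (`n < 13600 u⁵ ≤ u⁶`) this gives `n² < ℓ₀³` and `ℓ₀ ≤ n`.  Hence the law need only be
checked against LONG-SUPPORTED spread measures: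

* `exists_thick_measure_long` — the thick-queue measure with the long-arc support clause (parameters free);
* `exists_thick_measure_of_le_long` — the same at the `NNMonotoneExpBound` parameters (`r = 4u`, every `n ≥ T(u)`);
* ★★ `exp_lower_bound_of_longSpreadLaw` — **THE LONG-ARC ENGINE**: if `F : ℕ → ℕ` satisfies `1 ≤ 4 F(n) (n+1)² β` for every
  `n ≥ 3`, every threshold `ℓ₀ ≤ n` with `n² < ℓ₀³`, and every probability weighting of the nest-free perfect matchings of
  `[2n]` supported on matchings with all arcs of length `≥ ℓ₀` and respecting balanced splits with mass `≤ β`, then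
  `2^{n^{1/6}} ≤ F(n)` for all large `n`.

The proof of the engine is the tree's (`SpreadLaw.exp_lower_bound_of_spreadLaw`, itself `NNMonotoneExpBound.exp_lower_bound`)
verbatim, with the long-supported measure fed in.  First consumer: `…ShortLocal.lean` (short-arc-local cofactors are not
quasi-polynomial certificates — the unconditional form of `…ShortLocalConditional.lean`).
HONEST FRAMING: monotone-world engine about ONE measure; stmt-21181 stays OPEN; nothing here bears on `NNNotVP` or on
VP ≠ VNP (NOT proved).  No definitions, no named facts.
References: Hrubeš–Yehudayoff 2021 §6 [HrubesYehudayoff2021]; Jerrum–Snir 1982 [JerrumSnir1982].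
-/

noncomputable section

-- Sub = Summit single-conjunct layout: the duplicated namespace component is mandated by the tree.
set_option linter.dupNamespace false
set_option autoImplicit false

namespace Summit.ValiantsHypothesis.ValiantsHypothesis.Theorems.FifoMatching.NNDivisionHard.LongSpreadLaw

open Finset Filter Literature.Computability.AlgebraicComplexity
open Summit.ValiantsHypothesis.ValiantsHypothesis.Theorems.FifoMatching.NNMonotoneHard
open Summit.ValiantsHypothesis.ValiantsHypothesis.Theorems.FifoMatching.NNMonotoneExpBound
open Summit.ValiantsHypothesis.ValiantsHypothesis.Theorems.FifoMatching.NNDivisionHard.ThickMeasureSupport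
  (exists_thick_measure_supported)
open Summit.ValiantsHypothesis.ValiantsHypothesis.Theorems.FifoMatching.NNDivisionHard.PadWordLongArcs
  (cast_fifo_padWord_arcs_long)
open scoped NNReal Topology

/-! ### §1 The thick-queue measure is supported on long-arc matchings -/

/-- **The thick-queue measure, long-arc form.**  Under the hypotheses of `NNMonotoneHard.exists_thick_measure` there is a
probability weighting of the nest-free perfect matchings of `[2n]` respecting every balanced split with mass `≤ 2N (3/4)^r`
and **supported on matchings all of whose arcs have length `≥ L − m + 1`**. [cite: HrubesYehudayoff2021, §6 Problem 2] -/
theorem exists_thick_measure_long {n L N m K J r : ℕ} (hM : L + N + L = 2 * n)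
    (hmL : m ≤ L) (hm : 1 ≤ m) (hK : 2 * L + 4 * m + 2 ≤ K) (hJ : J * K + 1 ≤ N)
    (hr1 : 4 * r ≤ J) (hr3 : 2 * m * r + 3 * m ≤ L)
    (hreg : 3 * (2 * K * r + (2 * n - J * K)) ≤ 2 * n)
    (hNpos : 0 < N)
    (hband : 2 * (N : ℝ) * Real.exp (-((m : ℝ) ^ 2 / (2 * N))) * 2 ^ N ≤ 2 ^ N / (2 * N)) :
    ∃ μ : (Fin (2 * n) → Fin (2 * n)) → ℝ≥0,
      (∑ Mt ∈ nestFreeMatchings (2 * n), μ Mt = 1) ∧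
      (∀ S : Finset (Fin (2 * n)), 2 * n < 3 * S.card → 3 * S.card ≤ 4 * n →
        (∑ Mt ∈ (nestFreeMatchings (2 * n)).filter (fun Mt => ∀ i, i ∈ S ↔ Mt i ∈ S), μ Mt)
          ≤ (2 * N : ℝ≥0) * ((3 : ℝ≥0) / 4) ^ r) ∧
      (∀ Mt ∈ nestFreeMatchings (2 * n), μ Mt ≠ 0 →
        ∀ i ∈ openers Mt, (i : ℕ) + (L - m + 1) ≤ (Mt i : ℕ)) := by
  obtain ⟨μ, h1, h2, h3⟩ := exists_thick_measure_supported hM hmL hm hK hJ hr1 hr3 hreg hNpos hband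
  refine ⟨μ, h1, h2, fun Mt _ hMt => ?_⟩
  obtain ⟨v, hb, hbd, rfl⟩ := h3 Mt hMt
  exact cast_fifo_padWord_arcs_long v hM hb hbd hmL hm

/-- **The long-arc thick-queue measure at every large length** (parameters of `NNMonotoneExpBound.exists_thick_measure_of_le`:
`u ≥ 1`, `m = u³`, `L = 8mu + 3m`, `K = 2L + 4m + 2`, `N = 2n − 2L`, `n ≥ 12Ku + 3L + 2K`, band estimate): mass `≤ 2N (3/4)^{4u}`
on every balanced split, support on matchings with all arcs of length `≥ L − m + 1 = 8u⁴ + 2u³ + 1`. [folklore] -/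
theorem exists_thick_measure_of_le_long {u n m L K N : ℕ} (hu : 1 ≤ u) (hm : m = u ^ 3)
    (hL : L = 8 * m * u + 3 * m) (hK : K = 2 * L + 4 * m + 2) (hN : N = 2 * n - 2 * L)
    (hT : 12 * K * u + 3 * L + 2 * K ≤ n)
    (hband : 2 * (N : ℝ) * Real.exp (-((m : ℝ) ^ 2 / (2 * N))) * 2 ^ N ≤ 2 ^ N / (2 * N)) :
    ∃ μ : (Fin (2 * n) → Fin (2 * n)) → ℝ≥0,
      (∑ Mt ∈ nestFreeMatchings (2 * n), μ Mt = 1) ∧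
      (∀ S : Finset (Fin (2 * n)), 2 * n < 3 * S.card → 3 * S.card ≤ 4 * n →
        (∑ Mt ∈ (nestFreeMatchings (2 * n)).filter (fun Mt => ∀ i, i ∈ S ↔ Mt i ∈ S), μ Mt)
          ≤ (2 * N : ℝ≥0) * ((3 : ℝ≥0) / 4) ^ (4 * u)) ∧
      (∀ Mt ∈ nestFreeMatchings (2 * n), μ Mt ≠ 0 →
        ∀ i ∈ openers Mt, (i : ℕ) + (L - m + 1) ≤ (Mt i : ℕ)) := by
  set J : ℕ := (N - 1) / K with hJ
  have hKpos : 0 < K := by rw [hK]; omega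
  have hm1 : 1 ≤ m := by rw [hm]; exact Nat.one_le_pow _ _ hu
  -- linearise the products for `omega`
  have eT : 12 * K * u = 12 * (K * u) := by ring
  have eL : 8 * m * u = 8 * (m * u) := by ring
  have er : 2 * K * (4 * u) = 8 * (K * u) := by ring
  have e16 : 4 * (4 * u) * K = 16 * (K * u) := by ring
  have emr : 2 * m * (4 * u) + 3 * m = 8 * (m * u) + 3 * m := by ring
  rw [eT] at hT
  have hLn : L ≤ n := by omega
  have hM : L + N + L = 2 * n := by rw [hN]; omega
  have hmL : m ≤ L := by rw [hL, eL]; omega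
  have hKe : 2 * L + 4 * m + 2 ≤ K := by rw [hK]
  have hNpos : 0 < N := by rw [hN]; omega
  -- `J K ≤ N - 1 < J K + K`
  have hdiv : K * J + (N - 1) % K = N - 1 := by rw [hJ]; exact Nat.div_add_mod (N - 1) K
  have hmod : (N - 1) % K < K := Nat.mod_lt _ hKpos
  have eKJ : K * J = J * K := Nat.mul_comm _ _
  have hJK : J * K + 1 ≤ N := by omega
  have hJK' : N ≤ J * K + K := by omega
  have hr1 : 4 * (4 * u) ≤ J := by
    rw [hJ, Nat.le_div_iff_mul_le hKpos, e16]
    omega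
  have hr3 : 2 * m * (4 * u) + 3 * m ≤ L := by rw [emr, hL, eL]
  have hreg : 3 * (2 * K * (4 * u) + (2 * n - J * K)) ≤ 2 * n := by
    rw [er]
    omega
  exact exists_thick_measure_long hM hmL hm1 hKe hJK hr1 hr3 hreg hNpos hband

/-! ### §2 The long-arc engine -/

/-- ★★ **THE LONG-ARC THICK-QUEUE ENGINE.**  Let `F : ℕ → ℕ` obey the LONG spread law: for every `n ≥ 3`, every threshold
`ℓ₀ ≤ n` with `n² < ℓ₀³`, every probability weighting `μ` of the nest-free perfect matchings of `[2n]` supported on matchings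
all of whose arcs have length `≥ ℓ₀`, and every `β` bounding the mass of every balanced vertex split (`2n < 3|S| ≤ 4n`),
`1 ≤ 4 · F(n) · (n+1)² · β`.  Then `2^{n^{1/6}} ≤ F(n)` for all large `n`. [cite: HrubesYehudayoff2021, §6 Problem 2] -/
theorem exp_lower_bound_of_longSpreadLaw (F : ℕ → ℕ)
    (hF : ∀ n : ℕ, 3 ≤ n → ∀ ℓ₀ : ℕ, n ^ 2 < ℓ₀ ^ 3 → ℓ₀ ≤ n →
      ∀ (β : ℝ≥0) (μ : (Fin (2 * n) → Fin (2 * n)) → ℝ≥0),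
      (∑ M ∈ nestFreeMatchings (2 * n), μ M = 1) →
      (∀ M ∈ nestFreeMatchings (2 * n), μ M ≠ 0 → ∀ i ∈ openers M, (i : ℕ) + ℓ₀ ≤ (M i : ℕ)) →
      (∀ S : Finset (Fin (2 * n)), 2 * n < 3 * S.card → 3 * S.card ≤ 4 * n →
        (∑ M ∈ (nestFreeMatchings (2 * n)).filter (fun M => ∀ i, i ∈ S ↔ M i ∈ S), μ M) ≤ β) →
      (1 : ℝ) ≤ 4 * (F n : ℝ) * ((n : ℝ) + 1) ^ 2 * (β : ℝ)) :
    ∃ n₀ : ℕ, ∀ n : ℕ, n₀ ≤ n → (2 : ℝ) ^ ((n : ℝ) ^ ((1 : ℝ) / 6)) ≤ (F n : ℝ) := by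
  -- the two asymptotic requirements and `u ≥ 13600`, eventually in `u`
  have hexp0 : 0 ≤ Real.exp (-(1 / 54400 : ℝ)) := (Real.exp_pos _).le
  have hexp1 : Real.exp (-(1 / 54400 : ℝ)) < 1 := Real.exp_lt_one_iff.2 (by norm_num)
  have E1 := eventually_const_mul_pow_mul_pow_lt 10 (C := 4 * 27200 ^ 2) hexp0 hexp1 one_pos
  have E2 := eventually_const_mul_pow_mul_pow_lt 15 (C := 4 * 13601 ^ 2 * 54400)
    (a := 81 / 128) (by norm_num) (by norm_num) one_pos
  obtain ⟨u₀, hu₀⟩ := Filter.eventually_atTop.1 ((eventually_ge_atTop 13600).and (E1.and E2))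
  -- threshold `T(u) = 192u⁵ + 176u⁴ + 29u³ + 24u + 4`; `n₀ := T(u₀)`
  refine ⟨192 * u₀ ^ 5 + 176 * u₀ ^ 4 + 29 * u₀ ^ 3 + 24 * u₀ + 4, fun n hn => ?_⟩
  -- choose `u`: the largest with `T(u) ≤ n`
  set u : ℕ := Nat.findGreatest
    (fun u => 192 * u ^ 5 + 176 * u ^ 4 + 29 * u ^ 3 + 24 * u + 4 ≤ n) n with hu_def
  have hu₀n : u₀ ≤ n := le_trans (by omega) hn
  have hu₀u : u₀ ≤ u :=
    Nat.le_findGreatest (P := fun u => 192 * u ^ 5 + 176 * u ^ 4 + 29 * u ^ 3 + 24 * u + 4 ≤ n)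
      hu₀n hn
  have hTu : 192 * u ^ 5 + 176 * u ^ 4 + 29 * u ^ 3 + 24 * u + 4 ≤ n :=
    Nat.findGreatest_spec (P := fun u => 192 * u ^ 5 + 176 * u ^ 4 + 29 * u ^ 3 + 24 * u + 4 ≤ n)
      hu₀n hn
  have hule : u ≤ n :=
    Nat.findGreatest_le (P := fun u => 192 * u ^ 5 + 176 * u ^ 4 + 29 * u ^ 3 + 24 * u + 4 ≤ n) n
  have hun : u < n := by
    rcases hule.eq_or_lt with h | h
    · exfalso
      have hTu' := hTu
      rw [h] at hTu'
      omega
    · exact h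
  have hTu1 : ¬ (192 * (u + 1) ^ 5 + 176 * (u + 1) ^ 4 + 29 * (u + 1) ^ 3 + 24 * (u + 1) + 4 ≤ n) :=
    Nat.findGreatest_is_greatest
      (P := fun u => 192 * u ^ 5 + 176 * u ^ 4 + 29 * u ^ 3 + 24 * u + 4 ≤ n) (lt_add_one u)
      (by omega)
  obtain ⟨hu13600, hE1, hE2⟩ := hu₀ u hu₀u
  have hu1 : 1 ≤ u := le_trans (by norm_num) hu13600
  -- `n < T(u+1) ≤ 13600 u⁵`
  have hn_lt : n < 13600 * u ^ 5 := by
    have h2 : u + 1 ≤ 2 * u := by omega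
    have h5 : (u + 1) ^ 5 ≤ 32 * u ^ 5 := by
      calc (u + 1) ^ 5 ≤ (2 * u) ^ 5 := Nat.pow_le_pow_left h2 5
        _ = 32 * u ^ 5 := by ring
    have h1' : 1 ≤ u + 1 := by omega
    have h45 : (u + 1) ^ 4 ≤ (u + 1) ^ 5 := Nat.pow_le_pow_right h1' (by norm_num)
    have h35 : (u + 1) ^ 3 ≤ (u + 1) ^ 5 := Nat.pow_le_pow_right h1' (by norm_num)
    have h15 : (u + 1) ≤ (u + 1) ^ 5 := by
      calc (u + 1) = (u + 1) ^ 1 := (pow_one _).symm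
        _ ≤ (u + 1) ^ 5 := Nat.pow_le_pow_right h1' (by norm_num)
    omega
  -- the parameters
  set m : ℕ := u ^ 3 with hm
  set L : ℕ := 8 * m * u + 3 * m with hL
  set K : ℕ := 2 * L + 4 * m + 2 with hK
  set N : ℕ := 2 * n - 2 * L with hN
  have hT : 12 * K * u + 3 * L + 2 * K ≤ n := by
    have : 12 * K * u + 3 * L + 2 * K = 192 * u ^ 5 + 176 * u ^ 4 + 29 * u ^ 3 + 24 * u + 4 := by
      simp only [hK, hL, hm]; ring
    rw [this]; exact hTu
  have hNle : N ≤ 2 * n := by rw [hN]; omega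
  have hNpos : 0 < N := by
    have eT : 12 * K * u = 12 * (K * u) := by ring
    rw [eT] at hT
    rw [hN]; omega
  have hn3 : 3 ≤ n := by omega
  -- real-valued size bounds
  have hur : (1 : ℝ) ≤ u := by exact_mod_cast hu1
  have hnr : (n : ℝ) ≤ 13600 * (u : ℝ) ^ 5 := by exact_mod_cast hn_lt.le
  have hNr : (0 : ℝ) < N := by exact_mod_cast hNpos
  have hN2 : (N : ℝ) ≤ 2 * n := by exact_mod_cast hNle
  have hNr5 : (N : ℝ) ≤ 27200 * (u : ℝ) ^ 5 := by linarith
  -- the band estimate `2N e^{-m²/(2N)} 2^N ≤ 2^N/(2N)`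
  have hband : 2 * (N : ℝ) * Real.exp (-((m : ℝ) ^ 2 / (2 * N))) * 2 ^ N ≤ 2 ^ N / (2 * N) := by
    have h1 : (u : ℝ) / 54400 ≤ (m : ℝ) ^ 2 / (2 * N) := by
      rw [div_le_div_iff₀ (by norm_num) (mul_pos (by norm_num) hNr)]
      have hm6 : (m : ℝ) ^ 2 = (u : ℝ) ^ 6 := by
        rw [hm]; push_cast; ring
      rw [hm6]
      have : (u : ℝ) * (2 * N) ≤ (u : ℝ) * (54400 * (u : ℝ) ^ 5) := by
        have hu0 : (0 : ℝ) ≤ u := by positivity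
        nlinarith
      nlinarith
    have h2 : Real.exp (-((m : ℝ) ^ 2 / (2 * N))) ≤ Real.exp (-(1 / 54400 : ℝ)) ^ u := by
      rw [← Real.exp_nat_mul, Real.exp_le_exp]
      have : (u : ℝ) * -(1 / 54400 : ℝ) = -((u : ℝ) / 54400) := by ring
      rw [this]
      linarith
    have h3 : 4 * (N : ℝ) ^ 2 * Real.exp (-((m : ℝ) ^ 2 / (2 * N))) ≤ 1 := by
      calc 4 * (N : ℝ) ^ 2 * Real.exp (-((m : ℝ) ^ 2 / (2 * N)))
          ≤ 4 * (27200 * (u : ℝ) ^ 5) ^ 2 * Real.exp (-(1 / 54400 : ℝ)) ^ u := by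
            gcongr
        _ = 4 * 27200 ^ 2 * (u : ℝ) ^ 10 * Real.exp (-(1 / 54400 : ℝ)) ^ u := by ring
        _ ≤ 1 := hE1.le
    have hN0 : (N : ℝ) ≠ 0 := hNr.ne'
    rw [show 2 * (N : ℝ) * Real.exp (-((m : ℝ) ^ 2 / (2 * N))) * 2 ^ N
        = (4 * (N : ℝ) ^ 2 * Real.exp (-((m : ℝ) ^ 2 / (2 * N)))) * (2 ^ N / (2 * N)) by
      field_simp; ring]
    calc (4 * (N : ℝ) ^ 2 * Real.exp (-((m : ℝ) ^ 2 / (2 * N)))) * (2 ^ N / (2 * N))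
        ≤ 1 * (2 ^ N / (2 * N)) := by gcongr
      _ = 2 ^ N / (2 * N) := one_mul _
  -- the measure and the spread law
  obtain ⟨μ, hμ1, hμS, hμlong⟩ := exists_thick_measure_of_le_long hu1 hm hL hK hN hT hband
  -- the long-arc threshold `ℓ₀ = L - m + 1 = 8u⁴ + 2u³ + 1`: `n² < ℓ₀³` and `ℓ₀ ≤ n`
  have emu : 8 * m * u = 8 * (m * u) := by ring
  have e4 : u ^ 4 = m * u := by rw [hm]; ring
  have hℓ4 : u ^ 4 ≤ L - m + 1 := by rw [e4, hL, emu]; omega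
  have hu6 : n < u ^ 6 := by
    have h1 : 13600 * u ^ 5 ≤ u * u ^ 5 := Nat.mul_le_mul_right _ hu13600
    have h2 : u * u ^ 5 = u ^ 6 := by ring
    omega
  have hℓ3 : n ^ 2 < (L - m + 1) ^ 3 := by
    calc n ^ 2 < (u ^ 6) ^ 2 := Nat.pow_lt_pow_left hu6 two_ne_zero
      _ = (u ^ 4) ^ 3 := by ring
      _ ≤ (L - m + 1) ^ 3 := Nat.pow_le_pow_left hℓ4 3
  have hℓn : L - m + 1 ≤ n := by
    have eT : 12 * K * u = 12 * (K * u) := by ring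
    have hT' := hT
    rw [eT] at hT'
    have hm1 : 1 ≤ m := by rw [hm]; exact Nat.one_le_pow _ _ hu1
    rw [hL, emu]
    rw [hL, emu] at hT'
    omega
  have hmain := hF n hn3 (L - m + 1) hℓ3 hℓn _ μ hμ1 hμlong hμS
  push_cast at hmain
  -- `2^u ≤ F n`
  set s : ℕ := F n with hs
  have h2u : (2 : ℝ) ^ u ≤ (s : ℝ) := by
    by_contra hlt
    rw [not_le] at hlt
    have hpos : (0 : ℝ) < ((n : ℝ) + 1) ^ 2 * (2 * (N : ℝ) * (3 / 4 : ℝ) ^ (4 * u)) := by positivity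
    have hlt' : 4 * (s : ℝ) * ((n : ℝ) + 1) ^ 2 * (2 * (N : ℝ) * (3 / 4 : ℝ) ^ (4 * u))
        < 4 * (2 : ℝ) ^ u * ((n : ℝ) + 1) ^ 2 * (2 * (N : ℝ) * (3 / 4 : ℝ) ^ (4 * u)) := by
      have := mul_lt_mul_of_pos_right hlt hpos
      nlinarith
    have hpow : (2 : ℝ) ^ u * (3 / 4 : ℝ) ^ (4 * u) = (81 / 128 : ℝ) ^ u := by
      rw [pow_mul, ← mul_pow]; norm_num
    have hn1 : (n : ℝ) + 1 ≤ 13601 * (u : ℝ) ^ 5 := by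
      have : (1 : ℝ) ≤ (u : ℝ) ^ 5 := one_le_pow₀ hur
      linarith
    have hB : ((n : ℝ) + 1) ^ 2 ≤ (13601 * (u : ℝ) ^ 5) ^ 2 := by gcongr
    have hfin : 4 * (2 : ℝ) ^ u * ((n : ℝ) + 1) ^ 2 * (2 * (N : ℝ) * (3 / 4 : ℝ) ^ (4 * u)) < 1 := by
      calc 4 * (2 : ℝ) ^ u * ((n : ℝ) + 1) ^ 2 * (2 * (N : ℝ) * (3 / 4 : ℝ) ^ (4 * u))
          = 4 * ((n : ℝ) + 1) ^ 2 * (2 * (N : ℝ)) * ((2 : ℝ) ^ u * (3 / 4 : ℝ) ^ (4 * u)) := by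
            ring
        _ = 4 * ((n : ℝ) + 1) ^ 2 * (2 * (N : ℝ)) * (81 / 128 : ℝ) ^ u := by rw [hpow]
        _ ≤ 4 * (13601 * (u : ℝ) ^ 5) ^ 2 * (2 * (27200 * (u : ℝ) ^ 5)) * (81 / 128 : ℝ) ^ u := by
            gcongr
        _ = 4 * 13601 ^ 2 * 54400 * (u : ℝ) ^ 15 * (81 / 128 : ℝ) ^ u := by ring
        _ < 1 := hE2
    linarith
  -- `n^{1/6} ≤ u`
  have hroot : (n : ℝ) ^ ((1 : ℝ) / 6) ≤ u := by
    have hn6 : (n : ℝ) ≤ (u : ℝ) ^ 6 := by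
      have h13600 : (13600 : ℝ) ≤ u := by exact_mod_cast hu13600
      have hu5 : (0 : ℝ) ≤ (u : ℝ) ^ 5 := by positivity
      calc (n : ℝ) ≤ 13600 * (u : ℝ) ^ 5 := hnr
        _ ≤ (u : ℝ) * (u : ℝ) ^ 5 := mul_le_mul_of_nonneg_right h13600 hu5
        _ = (u : ℝ) ^ 6 := by ring
    have h := Real.rpow_le_rpow (Nat.cast_nonneg n) hn6 (by norm_num : (0 : ℝ) ≤ 1 / 6)
    have h6 : ((u : ℝ) ^ 6) ^ ((1 : ℝ) / 6) = u := by
      rw [show ((1 : ℝ) / 6) = ((6 : ℕ) : ℝ)⁻¹ by norm_num]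
      exact Real.pow_rpow_inv_natCast (Nat.cast_nonneg u) (by norm_num)
    rw [h6] at h
    exact h
  calc (2 : ℝ) ^ ((n : ℝ) ^ ((1 : ℝ) / 6)) ≤ (2 : ℝ) ^ ((u : ℕ) : ℝ) :=
        Real.rpow_le_rpow_of_exponent_le (by norm_num) hroot
    _ = (2 : ℝ) ^ u := Real.rpow_natCast 2 u
    _ ≤ s := h2u

end Summit.ValiantsHypothesis.ValiantsHypothesis.Theorems.FifoMatching.NNDivisionHard.LongSpreadLaw

end
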